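import Summits.Schanuel.Schanuel.Theorems.RootDecomp1KLevelFinite06

/-!
# RootDecomp1KLevelFinite — lens 1, generation 51 ADDENDUM «BOTH SPLIT CONJUGATE-POLES LEAVES CLOSED: normShapeLF_holds» (§8 SplitGrades) — continuation (RootDecomp1KLevelFinite07): §8.4 one level: integer bookkeeping + §8.5 the 𝕂-side

(lens-1 g51 ADDENDUM kernel K″ = HOME/decomp-schanuel-lens-1/g51/LevelFiniteSplit.lean 375ea065…, 2255 l = node-10 K b1fbaeff… VERBATIM (843/843 lines in order; ported as RootDecomp1KLevelFinite01–04) + TWO pure insertions: an addendum module docstring and `§8 section SplitGrades` (K″ l.863–2252, 75 decls); same single import …RootDecomp1KXLinear05; P″ LevelFiniteSplitProbe.lean rc 0 / C₀″ rc 0 / C″ LevelFiniteSplitCtrl.lean rc 1 = 10 planted; ADDENDUM/NODE L2486 / REQUEST L2487, critic VERDICT L2488: CLEARED under RULE K-R40 (ii)/(v) — ONE THEOREM ×1 «CONJUGATE-POLES LEAVES CLOSED: (NormShapeLevels g q a D).Finite for EVERY NormShapeHyp g q a D, uniformly over all grades, by a two-pass 2-adic Ridout argument in PadicAlgCl 2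 on the tree's `RootDecomp1KXLinearCore.ridout_step`»; writer re-check L2489; PORT GO. Port by census-1 gen 21 of §8 as `RootDecomp1KLevelFinite05–09` continuing the 01–04 chain: 05 = §8.0 norms of integers in `PadicAlgCl 2`, binary forms `hform`, + §8.1 Bezout identities (`cpoly`, `bezout_forms`); 06 = §8.2 resultant data of a conjugate-poles shape + §8.3 the monicised quadratic in 𝕂 (`two_roots`, `ghatc`); 07 = §8.4 one level: integer bookkeeping (`psNumer_le`, `hform_two_eq`, …) + §8.5 the 𝕂-side (`nearest_root`, root extraction, `lamq`); 08 = §8.6 one level: height, arithmetic and the 2-adic closeness (`heightC`, `level_arith`, `level_padic`); 09 = §8.7 assembly **`normShapeLF_holds`** + §8.8 corollaries `normShapeLFSplitImag_holds` / `normShapeLFSplitReal_holds` (the two K binders LITERALLY), `levelFinite_of_siegelShapes''` / `thinFibre_of_siegelShapes''` / `b_of_siegelShapes''` (⟸ `SiegelShapes` ALONE) + §8.9 hyp-free instances `normShapeCurve`, `levelFinite_normShapeCurve`, `levelFinite_sqrt17_curve` (g47's residual (δ) family member DECIDED). PORT EDITS (census convention, pre-sanctioned L2488): `psNumer_pos'`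 privatised (homonym statement of private tree `psNumer_pos`); `isCoprime_num_den` stays private (privatised in 03; private copies where §8 calls it); 24 one-line helper docstrings (statements quoted); `section SplitGrades` with its two `open … (…)` lines closed / re-opened per part, the `open … (bev_map_C)` of §8.9 travels inside 09; statements and proofs otherwise verbatim, no renames, no heartbeat lines. `--supports stmt-Schanuel-33364`; no census credit carried; rung 0 — nothing here proves Schanuel, 33364, 31077, 33363, SiegelShapes, or ThinFibre m₀ / (b) hypothesis-free.)
-/

noncomputable section

open Polynomial LiouvilleNumber
open scoped Nat

namespace Summit.Schanuel.Schanuel.Theorems.RootDecomp1KLevelFinite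

open Summit.Schanuel.Schanuel.Theorems.RootDecomp1KSkelCell (iota SkelLiouville SkelLiouvilleFix
  skelLiouville_iff_fix SkelLiouvilleFix.mono)
open Summit.Schanuel.Schanuel.Theorems.RootDecomp1KTwoBaseCell (psNumer partialSum_eq_psNumer_div coprime_psNumer
  sb_of_range_eq')
open Summit.Schanuel.Schanuel.Theorems.RootDecomp1KRelLiouvilleCell (partialSum_two_strictMono)
open Summit.Schanuel.Schanuel.Theorems.RootDecomp1KDegreeLadder
open Summit.Schanuel.Schanuel.Theorems.RootDecomp1KXLinear (xLinP bev_xLinP aeval_ratCast levels_finite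
  thinFibreAt_mul_left)
open Summit.Schanuel.Schanuel.Theorems.RootDecomp1KHyper (SB SFset sb_of_algebraicIndependent)

section SplitGrades

open Summit.Schanuel.Schanuel.Theorems.RootDecomp1KXLinearCore (roots_structure ridout_step)
open Summit.Schanuel.Schanuel.Theorems.RootDecomp1KXLinear (norm_psNumer_sub_one)

/-! ### §8.4 One level: the integer bookkeeping (`G = p_N κ`, `2^{N!}κ = D Q^a`, `2`-adic splitting) -/

/-- `(N : ℕ) : 0 < psNumer 2 N`. -/
private theorem psNumer_pos' (N : ℕ) : 0 < psNumer 2 N := by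
  unfold psNumer
  exact Finset.sum_pos (fun i _ => pow_pos two_pos _) (Finset.nonempty_range_iff.mpr (Nat.succ_ne_zero N))

/-- `(N : ℕ) : (psNumer 2 N : ℝ) ≤ 2 * 2 ^ N !`. -/
theorem psNumer_le (N : ℕ) : (psNumer 2 N : ℝ) ≤ 2 * 2 ^ N ! := by
  have h' : (sQ N : ℚ) ≤ 2 := (le_abs_self _).trans (abs_sQ_le N)
  rw [sQ, div_le_iff₀ (by positivity)] at h'
  exact_mod_cast h'

/-- `(q : ℤ[X]) (u v : ℤ) : hform q.coeff 2 u v = q.coeff 2 * u ^ 2 + q.coeff 1 * u * v + q.coeff 0 * v ^ 2`. -/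
theorem hform_two_eq (q : ℤ[X]) (u v : ℤ) :
    hform q.coeff 2 u v = q.coeff 2 * u ^ 2 + q.coeff 1 * u * v + q.coeff 0 * v ^ 2 := by
  simp [hform, Finset.sum_range_succ]; ring

/-- the level identity in homogeneous form: `2^{N!} G(u,v) = D · p_N · Q(u,v)^a`. -/
theorem level_identity {g q : ℤ[X]} {a : ℕ} {D : ℤ} {t : ℚ} {N : ℕ} (hq : q.natDegree = 2)
    (hga : g.natDegree ≤ 2 * a) (h : aeval t g = D * sQ N * (aeval t q) ^ a) :
    (2 : ℤ) ^ N ! * hform g.coeff (2 * a) t.num t.den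
      = D * (psNumer 2 N : ℤ) * (hform q.coeff 2 t.num t.den) ^ a := by
  have := normLevel_identity hq hga h
  rw [show hform g.coeff (2 * a) t.num (t.den : ℤ)
      = ∑ i ∈ Finset.range (2 * a + 1), g.coeff i * t.num ^ i * (t.den : ℤ) ^ (2 * a - i) by simp [hform],
    hform_two_eq]
  exact this

/-- `Q(u,v) ≠ 0` (no rational root). -/
theorem Qform_ne_zero {q : ℤ[X]} (hq : q.natDegree = 2) (hnr : ∀ t : ℚ, aeval t q ≠ 0) (t : ℚ) :
    hform q.coeff 2 t.num t.den ≠ 0 := by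
  intro h0
  have := hform_num_den q hq.le t
  rw [h0, Int.cast_zero] at this
  have hd : (t.den : ℚ) ^ 2 ≠ 0 := pow_ne_zero _ (Nat.cast_ne_zero.mpr t.den_nz)
  exact hnr t ((mul_eq_zero.mp this.symm).resolve_left hd)

/-- **Level bookkeeping.** `G = p_N κ`, `2^{N!} κ = D Q^a`, `κ ≠ 0`, and the height relation `|G| ≤ 2|D||Q|^a`. -/
theorem level_kappa {g q : ℤ[X]} {a : ℕ} {D : ℤ} {t : ℚ} {N : ℕ} (hq : q.natDegree = 2)
    (hnr : ∀ t : ℚ, aeval t q ≠ 0) (hga : g.natDegree ≤ 2 * a) (hD : D ≠ 0) (hN : 2 ≤ N)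
    (h : aeval t g = D * sQ N * (aeval t q) ^ a) :
    ∃ κ : ℤ, hform g.coeff (2 * a) t.num t.den = psNumer 2 N * κ ∧
      (2 : ℤ) ^ N ! * κ = D * (hform q.coeff 2 t.num t.den) ^ a ∧ κ ≠ 0 ∧
      |((hform g.coeff (2 * a) t.num t.den : ℤ) : ℝ)|
        ≤ 2 * |(D : ℝ)| * |((hform q.coeff 2 t.num t.den : ℤ) : ℝ)| ^ a := by
  set G := hform g.coeff (2 * a) t.num t.den with hG
  set Q := hform q.coeff 2 t.num t.den with hQ
  have hid := level_identity hq hga h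
  have hQ0 : Q ≠ 0 := Qform_ne_zero hq hnr t
  have hp0 : (psNumer 2 N : ℤ) ≠ 0 := by exact_mod_cast (psNumer_pos' N).ne'
  have hcop : IsCoprime (psNumer 2 N : ℤ) ((2 : ℤ) ^ N !) := by
    have := Nat.isCoprime_iff_coprime.mpr ((coprime_psNumer 2 hN).pow_right (N !))
    exact_mod_cast this
  have hdvd : (psNumer 2 N : ℤ) ∣ G := by
    apply hcop.dvd_of_dvd_mul_left
    exact ⟨D * Q ^ a, by rw [hid]; ring⟩
  obtain ⟨κ, hκ⟩ := hdvd
  refine ⟨κ, hκ, ?_, ?_, ?_⟩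
  · have : (psNumer 2 N : ℤ) * (2 ^ N ! * κ) = (psNumer 2 N : ℤ) * (D * Q ^ a) := by
      calc _ = 2 ^ N ! * G := by rw [hκ]; ring
        _ = _ := by rw [hid]; ring
    exact mul_left_cancel₀ hp0 this
  · rintro rfl
    rw [mul_zero] at hκ
    have : (2 : ℤ) ^ N ! * G = 0 := by rw [hκ, mul_zero]
    rw [hid] at this
    exact (mul_ne_zero (mul_ne_zero hD hp0) (pow_ne_zero _ hQ0)) this
  · have hidR : (2 : ℝ) ^ N ! * (G : ℝ) = D * (psNumer 2 N : ℝ) * (Q : ℝ) ^ a := by exact_mod_cast hid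
    have hp := psNumer_le N
    have h2 : (0 : ℝ) < 2 ^ N ! := by positivity
    have : (2 : ℝ) ^ N ! * |(G : ℝ)| ≤ 2 ^ N ! * (2 * |(D : ℝ)| * |(Q : ℝ)| ^ a) := by
      calc (2 : ℝ) ^ N ! * |(G : ℝ)| = |(2 : ℝ) ^ N ! * G| := by rw [abs_mul, abs_of_pos h2]
        _ = |(D : ℝ)| * (psNumer 2 N : ℝ) * |(Q : ℝ)| ^ a := by
            rw [hidR, abs_mul, abs_mul, abs_pow, Nat.abs_cast]
        _ ≤ |(D : ℝ)| * (2 * 2 ^ N !) * |(Q : ℝ)| ^ a := by gcongr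
        _ = _ := by ring
    exact le_of_mul_le_mul_left this h2

/-- `Q = 2^w · m` with `m` odd and `w` maximal. -/
theorem two_adic_decomp {Q : ℤ} (hQ : Q ≠ 0) :
    ∃ (w : ℕ) (m : ℤ), Q = 2 ^ w * m ∧ ¬ (2 : ℤ) ∣ m ∧ ∀ e : ℕ, (2 : ℤ) ^ e ∣ Q → e ≤ w := by
  set w : ℕ := padicValInt 2 Q with hw
  have hdvd : (2 : ℤ) ^ w ∣ Q := by rw [hw]; exact_mod_cast padicValInt_dvd (p := 2) Q
  obtain ⟨m, hm⟩ := hdvd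
  refine ⟨w, m, hm, ?_, ?_⟩
  · rintro ⟨k, hk⟩
    have h1 : (2 : ℤ) ^ (w + 1) ∣ Q := ⟨k, by rw [hm, hk]; ring⟩
    have := ((padicValInt_dvd_iff (p := 2) _ Q).mp (by exact_mod_cast h1)).resolve_left hQ
    omega
  · intro e he
    exact ((padicValInt_dvd_iff (p := 2) e Q).mp (by exact_mod_cast he)).resolve_left hQ

/-- `{e s : ℕ} {m : ℤ} (hm : ¬ (2 : ℤ) ∣ m) (h : (2 : ℤ) ^ e ∣ 2 ^ s * m) : e ≤ s`. -/
theorem le_of_pow_dvd_pow_mul_odd {e s : ℕ} {m : ℤ} (hm : ¬ (2 : ℤ) ∣ m) (h : (2 : ℤ) ^ e ∣ 2 ^ s * m) :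
    e ≤ s := by
  by_contra H
  have hs : s + 1 ≤ e := by omega
  have : (2 : ℤ) ^ (s + 1) ∣ 2 ^ s * m := (pow_dvd_pow 2 hs).trans h
  rw [pow_succ, mul_dvd_mul_iff_left (pow_ne_zero _ two_ne_zero)] at this
  exact hm this

/-- an odd integer is coprime to every power of two. -/
theorem isCoprime_two_pow_of_odd {m : ℤ} (hm : ¬ (2 : ℤ) ∣ m) (n : ℕ) : IsCoprime ((2 : ℤ) ^ n) m := by
  have h2 : IsCoprime (2 : ℤ) m := by
    refine ⟨-(m / 2), 1, ?_⟩
    omega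
  exact h2.pow_left

/-- `2^E ∤ v` as soon as `2^E ∣ Q(u,v)`, `2^E ∤ q₂`, `(u,v)` coprime. -/
theorem not_pow_dvd_den {q : ℤ[X]} {u v : ℤ} (huv : IsCoprime u v) {E : ℕ}
    (hE : ¬ (2 : ℤ) ^ E ∣ q.coeff 2) (hQ : (2 : ℤ) ^ E ∣ hform q.coeff 2 u v) : ¬ (2 : ℤ) ^ E ∣ v := by
  intro hv
  have hE0 : E ≠ 0 := by rintro rfl; simp at hE
  have h2v : (2 : ℤ) ∣ v := (dvd_pow_self 2 hE0).trans hv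
  have hu2 : IsCoprime ((2 : ℤ) ^ E) (u ^ 2) := (huv.symm.of_isCoprime_of_dvd_left h2v).pow
  rw [hform_two_eq] at hQ
  have h1 : (2 : ℤ) ^ E ∣ q.coeff 1 * u * v + q.coeff 0 * v ^ 2 :=
    dvd_add (Dvd.dvd.mul_left hv _) (Dvd.dvd.mul_left (dvd_pow hv two_ne_zero) _)
  have h3 : (2 : ℤ) ^ E ∣ u ^ 2 * q.coeff 2 := by
    have h4 : u ^ 2 * q.coeff 2
        = (q.coeff 2 * u ^ 2 + q.coeff 1 * u * v + q.coeff 0 * v ^ 2) - (q.coeff 1 * u * v + q.coeff 0 * v ^ 2) := by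
      ring
    rw [h4]; exact dvd_sub hQ h1
  exact hE (hu2.dvd_of_dvd_mul_left h3)

/-- eventually-large factorial gaps: `3 (N! + E + 1) ≤ 4 (N! − (N−1)!)` for `N ≥ 3E + 8`. -/
theorem factorial_gap_bound (E : ℕ) {N : ℕ} (hN : 3 * E + 8 ≤ N) :
    3 * (Nat.factorial N + E + 1) ≤ 4 * (Nat.factorial N - Nat.factorial (N - 1)) := by
  obtain ⟨n, rfl⟩ : ∃ n, N = n + 1 := ⟨N - 1, by omega⟩
  simp only [Nat.add_sub_cancel]
  have hf : Nat.factorial (n + 1) = (n + 1) * Nat.factorial n := Nat.factorial_succ n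
  have hn1 : 1 ≤ Nat.factorial n := Nat.one_le_iff_ne_zero.mpr (Nat.factorial_ne_zero n)
  have hnle : n ≤ Nat.factorial n := Nat.self_le_factorial n
  have hsub : Nat.factorial (n + 1) - Nat.factorial n = n * Nat.factorial n := by
    rw [hf, Nat.succ_mul, Nat.add_sub_cancel]
  rw [hsub, hf]
  nlinarith

/-! ### §8.5 The `𝕂`-side: nearest root, root extraction with algebraicity, exponent helpers -/

/-- nearest root: `‖x − ζ₀‖ · ‖e ζ₀^{e−1}‖ ≤ ‖x^e − γ‖` for the root `ζ₀` nearest to `x`. -/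
theorem nearest_root [DecidableEq (PadicAlgCl 2)] {T : Finset (PadicAlgCl 2)} (hne : T.Nonempty) {e : ℕ}
    {γ : PadicAlgCl 2} (hprod : ∀ u : PadicAlgCl 2, u ^ e - γ = ∏ ζ ∈ T, (u - ζ))
    (hder : ∀ ζ ∈ T, ∏ ζ' ∈ T.erase ζ, (ζ - ζ') = (e : PadicAlgCl 2) * ζ ^ (e - 1)) (x : PadicAlgCl 2) :
    ∃ ζ₀ ∈ T, ‖x - ζ₀‖ * ‖(e : PadicAlgCl 2) * ζ₀ ^ (e - 1)‖ ≤ ‖x ^ e - γ‖ := by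
  obtain ⟨ζ₀, hζ₀, hmin⟩ := T.exists_min_image (fun ζ => ‖x - ζ‖) hne
  refine ⟨ζ₀, hζ₀, ?_⟩
  rw [hprod x, norm_prod, ← Finset.mul_prod_erase T (fun ζ => ‖x - ζ‖) hζ₀, ← hder ζ₀ hζ₀, norm_prod]
  refine mul_le_mul_of_nonneg_left ?_ (norm_nonneg _)
  refine Finset.prod_le_prod (fun _ _ => norm_nonneg _) fun ζ hζ => ?_
  have hζT : ζ ∈ T := Finset.mem_of_mem_erase hζ
  calc ‖ζ₀ - ζ‖ = ‖(x - ζ) - (x - ζ₀)‖ := by congr 1; ring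
    _ ≤ max ‖x - ζ‖ ‖x - ζ₀‖ := normK_sub_le_max _ _
    _ = ‖x - ζ‖ := max_eq_left (hmin ζ hζT)

/-- **Root extraction.**  For `λ ≠ 0` algebraic: a finite set `T` of algebraic numbers (the `e`-th roots of `λ`) and
`C₁ > 0` with: `‖x^e − λ‖ ≤ η ⟹ ‖x − ζ‖ ≤ C₁ η` for some `ζ ∈ T`. -/
theorem root_extract (e : ℕ) (he : e ≠ 0) (lam : PadicAlgCl 2) (hlam : lam ≠ 0) (halg : IsAlgebraic ℚ lam) :
    ∃ (T : Finset (PadicAlgCl 2)) (C₁ : ℝ), 0 < C₁ ∧ (∀ ζ ∈ T, IsAlgebraic ℚ ζ) ∧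
      ∀ (x : PadicAlgCl 2) (η : ℝ), ‖x ^ e - lam‖ ≤ η → ∃ ζ ∈ T, ‖x - ζ‖ ≤ C₁ * η := by
  classical
  obtain ⟨T, hcard, hroot, hprod, hder⟩ := roots_structure e he lam hlam
  have hne : T.Nonempty := Finset.card_pos.mp (by rw [hcard]; exact Nat.pos_of_ne_zero he)
  have he' : (e : PadicAlgCl 2) ≠ 0 := Nat.cast_ne_zero.mpr he
  -- the smallest derivative norm
  obtain ⟨ζm, hζm, hζmin⟩ := T.exists_min_image (fun ζ => ‖(e : PadicAlgCl 2) * ζ ^ (e - 1)‖) hne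
  have hζne : ∀ ζ ∈ T, ζ ≠ 0 := by
    intro ζ hζ h0
    have := hroot ζ hζ
    rw [h0, zero_pow he] at this
    exact hlam this.symm
  set m₀ : ℝ := ‖(e : PadicAlgCl 2) * ζm ^ (e - 1)‖ with hm₀
  have hm₀pos : 0 < m₀ := norm_pos_iff.mpr (mul_ne_zero he' (pow_ne_zero _ (hζne ζm hζm)))
  refine ⟨T, 1 / m₀, by positivity, ?_, ?_⟩
  · intro ζ hζ
    exact IsAlgebraic.of_pow (Nat.pos_of_ne_zero he) (by rw [hroot ζ hζ]; exact halg)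
  · intro x η hη
    obtain ⟨ζ₀, hζ₀, hnear⟩ := nearest_root hne hprod hder x
    refine ⟨ζ₀, hζ₀, ?_⟩
    have hm : m₀ ≤ ‖(e : PadicAlgCl 2) * ζ₀ ^ (e - 1)‖ := hζmin ζ₀ hζ₀
    rw [one_div_mul_eq_div, le_div_iff₀ hm₀pos]
    calc ‖x - ζ₀‖ * m₀ ≤ ‖x - ζ₀‖ * ‖(e : PadicAlgCl 2) * ζ₀ ^ (e - 1)‖ := by gcongr
      _ ≤ ‖x ^ e - lam‖ := hnear
      _ ≤ η := hη

/-- `(z : ℤ) : IsIntegral ℚ (z : PadicAlgCl 2)`. -/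
theorem isIntegral_intCast_K (z : ℤ) : IsIntegral ℚ (z : PadicAlgCl 2) := by
  have : (z : PadicAlgCl 2) = algebraMap ℚ (PadicAlgCl 2) (z : ℚ) := by simp
  rw [this]; exact isIntegral_algebraMap

/-- `(c : ℕ → ℤ) (n : ℕ) {θ : PadicAlgCl 2} (hθ : IsIntegral ℚ θ) : IsIntegral ℚ (hform c n θ 1)`. -/
theorem isIntegral_hform (c : ℕ → ℤ) (n : ℕ) {θ : PadicAlgCl 2} (hθ : IsIntegral ℚ θ) :
    IsIntegral ℚ (hform c n θ 1) := by
  unfold hform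
  refine IsIntegral.sum _ fun i _ => ?_
  exact ((isIntegral_intCast_K _).mul (hθ.pow _)).mul (isIntegral_one.pow _)

/-- `{M t : ℕ} (h : 3 * t ≤ 2 * M) : (1 / 2 : ℝ) ^ M ≤ ((1 / 2 : ℝ) ^ t) ^ (3 / 2 : ℝ)`. -/
theorem half_pow_le_rpow_of_le {M t : ℕ} (h : 3 * t ≤ 2 * M) :
    (1 / 2 : ℝ) ^ M ≤ ((1 / 2 : ℝ) ^ t) ^ (3 / 2 : ℝ) := by
  rw [← Real.rpow_natCast ((1 : ℝ) / 2) t, ← Real.rpow_mul (by norm_num), ← Real.rpow_natCast ((1 : ℝ) / 2) M]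
  apply Real.rpow_le_rpow_of_exponent_ge (by norm_num) (by norm_num)
  have : (3 : ℝ) * t ≤ 2 * M := by exact_mod_cast h
  linarith

/-- `{w t : ℕ} (h : 2 * t ≤ w + 1) : (1 / 2 : ℝ) ^ w ≤ 2 * ((1 / 2 : ℝ) ^ t) ^ (3 / 2 : ℝ)`. -/
theorem half_pow_le_two_mul_rpow {w t : ℕ} (h : 2 * t ≤ w + 1) :
    (1 / 2 : ℝ) ^ w ≤ 2 * ((1 / 2 : ℝ) ^ t) ^ (3 / 2 : ℝ) := by
  have hx0 : (0 : ℝ) < (1 / 2 : ℝ) ^ t := by positivity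
  have hx1 : (1 / 2 : ℝ) ^ t ≤ 1 := pow_le_one₀ (by norm_num) (by norm_num)
  have hsq : ((1 / 2 : ℝ) ^ t) ^ 2 ≤ ((1 / 2 : ℝ) ^ t) ^ (3 / 2 : ℝ) := by
    rw [← Real.rpow_two]
    exact Real.rpow_le_rpow_of_exponent_ge hx0 hx1 (by norm_num)
  rcases Nat.eq_zero_or_pos t with rfl | ht
  · simp only [pow_zero, Real.one_rpow, mul_one]
    exact (pow_le_one₀ (by norm_num) (by norm_num)).trans (by norm_num)
  · have h1 : (1 / 2 : ℝ) ^ w ≤ (1 / 2 : ℝ) ^ (2 * t - 1) :=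
      pow_le_pow_of_le_one (by norm_num) (by norm_num) (by omega)
    have h2 : (1 / 2 : ℝ) ^ (2 * t - 1) = 2 * ((1 / 2 : ℝ) ^ t) ^ 2 := by
      rw [← pow_mul, show t * 2 = (2 * t - 1) + 1 by omega, pow_succ]; ring
    calc (1 / 2 : ℝ) ^ w ≤ 2 * ((1 / 2 : ℝ) ^ t) ^ 2 := h1.trans h2.le
      _ ≤ 2 * ((1 / 2 : ℝ) ^ t) ^ (3 / 2 : ℝ) := by gcongr

/-- `{x A B : ℝ} (hA : 1 ≤ A) (hB : 0 ≤ B) (h : x ^ 2 ≤ A * B ^ 2) : |x| ≤ A * B`. -/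
theorem abs_le_of_sq_le {x A B : ℝ} (hA : 1 ≤ A) (hB : 0 ≤ B) (h : x ^ 2 ≤ A * B ^ 2) : |x| ≤ A * B := by
  have hAB : 0 ≤ A * B := by positivity
  have : |x| ^ 2 ≤ (A * B) ^ 2 := by
    rw [sq_abs]
    calc x ^ 2 ≤ A * B ^ 2 := h
      _ ≤ A * B ^ 2 * A := le_mul_of_one_le_right (by positivity) hA
      _ = (A * B) ^ 2 := by ring
  nlinarith [abs_nonneg x, this]

end SplitGrades

end Summit.Schanuel.Schanuel.Theorems.RootDecomp1KLevelFinite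

end
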